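import Literature.InformationTheory.QuantumCodes.TwoBlockGASupportGroupBound
import Mathlib.RepresentationTheory.Maschke
import Mathlib.RingTheory.SimpleModule.Basic
import Mathlib.Algebra.Group.Subgroup.Pointwise
import HarnessLib

/-!
# LP24 Statement 10: the rank defects of a 2BGA code vanish when a support-group algebra is semisimple

Lin–Pryadko [LinPryadko2024, §IV.E] (held text arXiv:2306.16400, chunk p0011 L37–57), for the
two-block group-algebra code `LP[a,b]` (`A = L(a)`, `B = R(b)`, `TwoBlockGroupAlgebraCodes.lean`) over
`R = F[G]`, `G` an ARBITRARY finite group: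

> "An alternative sufficient condition follows from Statement 1 in the special case of a semisimple
> group algebra F[G], i.e., when the field characteristic p and the group rank ℓ are mutually prime.
> Indeed, any ideal in a semisimple group algebra is a summand, and for any a ∈ F[G], there exist
> idempotent elements e_a, f_a ∈ F[G] such that e_a² = e_a, f_a² = f_a, and e_a a = a, a f_a = a. In this
> case, we can choose E_A = L(e_a), F_A = L(f_a), which are guaranteed to commute with B ≡ R(b). A bit
> of thought gives a more general sufficient condition:
> **Statement 10.** Consider a code LP[a,b] over group algebra R ≡ F[G] such that the ideals aR and Ra
> (or the two ideals generated by b) be semisimple. Then, rank defects of the corresponding CSS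
> matrices vanish, δ_X = δ_Z = 0.
> Somewhat less general but easier to apply condition is, e.g., that the group algebra F[G_a] be
> semisimple, i.e., rank of the support group G_a be mutually prime with the field characteristic p."

(`G_a = ⟨supp a⟩ ≤ G` is the support group, the tree's `TwoBlockGA.suppGroup a`. The printed proof is App. §8.4,
chunk p0019 L87–95: «The result follows from Statement 1. Indeed, semisimple ideals aR and Ra are summands in R, and
can be generated by idempotents e_a and f_a, respectively, such that a = e_a a = a f_a. The conditions of Statement 1
are satisfied by taking E_A = L(e_a) and F_A = L(f_a) which necessarily commute with B = R(b).» Its first inference —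
«semisimple ideals … are summands in R» — is the step that fails outside a semisimple `R` (see §DirectSummand below and
`GroupAlgebraMinimalIdealProducts.statement10_moduleReading_counterexample`); the rest of the printed proof is exactly
the direct-summand argument typed here.) This file PROVES the support-group form, for every field `F` and every finite
group `G`, with the tree's INTRINSIC defects `TwoBlock.defectX A B = dim(col A ∩ col B) − rank(AB)`,
`TwoBlock.defectZ` (`TwoBlockCodeDimension.lean`: the least value of the printed, choice-dependent
defects; `= 0` iff some admissible choice gives the printed `0`):

* `LinPryadko2024_statement10` — **`char F ∤ |G_a|` or `char F ∤ |G_b|` ⇒ `δ_X = δ_Z = 0`**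
  (`defects_eq_zero_of_card_suppGroup_left/right`); `defects_eq_zero_of_card` — the semisimple-`F[G]`
  case `char F ∤ |G|`.
* Over `𝔽₂` (`TwoBlockGA.css a b`): `defects_eq_zero_of_odd` (`|G_a|` odd or `|G_b|` odd),
  `css_k_eq_two_mul_kS_of_odd` (**`k = 2k_S`**, from the tree's `k = 2k_S + δ_X + δ_Z`,
  `TwoBlock.css_k_eq_ga`), `even_css_k_of_odd`, `css_k_eq_two_mul_kS_of_odd_card` (`|G|` odd), and
  `le_min_dX_dZ_of_odd` — Statement 5's two-sided single-block-erasure LOWER bound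
  (`TwoBlock.LinPryadko2024_statement5`, `TwoBlockCodeDistanceBounds.lean`) with its defect
  hypotheses `δ_X = δ_Z = 0` DISCHARGED by oddness.
* One-block codeword bases (§IV.E p0011 L59–61, appended; in print for codes over commutative rings as
  [EberhardtSteffan2024, Cor. 2.5] «H pure ⟺ (c) ∩ (d) = (cd)»): `TwoBlock.exists_oneBlock_of_defectX_eq_zero`,
  `TwoBlock.defectX_eq_zero_iff_oneBlock` (**`δ_X = 0` ⟺ every `Z`-codeword = `Z`-stabilizer + `(u₀;0)` + `(0;v₀)`**),
  `TwoBlock.exists_oneBlock_of_defectZ_eq_zero` (`X` twin), and the binary odd-order forms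
  `TwoBlockGA.zCodeword_oneBlock_of_odd`, `xCodeword_oneBlock_of_odd`.
* Certificates for abelian codes with no hypothesis on `|G|` (appended): `AbelianTwoBlock.defects_eq_zero_of_certificate`
  (`e ⋆ e = e`, `a ⋆ r = e`, `e ⋆ s = a` ⇒ `δ_X = δ_Z = 0`), `…_of_certificate_right`, `css_k_eq_two_mul_kS_of_certificate`.
* Abelian two-block codes `AbelianTwoBlock.css a b` (`G`-circulants; GB, BB codes):
  `AbelianTwoBlock.defects_eq_zero_of_card` (any field, `char F ∤ |G|`),
  `AbelianTwoBlock.defects_eq_zero_of_odd`, `AbelianTwoBlock.css_k_eq_two_mul_kS_of_odd(_card)` over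
  `𝔽₂` — the semisimple case of Statement 9's clause "δ_X = δ_Z = 0 for any abelian 2BGA code", which
  FAILS without semisimplicity (`TwoBlock.fourTwoTwo_defects`: `LP[1+x,1+x]` over `𝔽₂[ℤ₂]` has
  `δ_X = δ_Z = 1`); via the re-indexing invariance `TwoBlock.defectX_submatrix`, `defectZ_submatrix`,
  `kS_submatrix`.

## Proof (the printed route of p0011 L37–45, made explicit)

1. `L(x y) = L(x) L(y)`, `R(x y) = R(y) R(x)`, `L(x) y = R(y) x = x y`, `L(a)ᵀ = L(â)`, `R(b)ᵀ = R(b̂)`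
   (`leftMul_leftMul_mulVec`, `rightMul_leftMul_mulVec`, `leftMul_mulVec_eq_rightMul_mulVec`,
   `transpose_leftMul`, `transpose_rightMul`).
2. Maschke (Mathlib: `IsSemisimpleRing (MonoidAlgebra F K)` for `NeZero (Nat.card K : F)`, and
   `IsSemisimpleRing.ideal_eq_span_idempotent`): the LEFT ideal `F[K]x` is `F[K]e` for an idempotent
   `e = r x` with `x e = x` (`exists_idempotent_leftIdeal`); transported along "coefficient function ↔
   element of `MonoidAlgebra F K`" only. For `x` supported in a subgroup `H` with `F[H]` semisimple the
   same data is computed in `F[H]` and pushed into `F[G]` along the (multiplicative) extension by zero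
   (`exists_idempotent_leftIdeal_of_subgroup`, `…_of_card_suppGroup`). (The abelian file's
   `AbelianTwoBlock.exists_isIdempotentGenerator`, `AbelianTwoBlockPaddedLogicals.lean`, is the
   two-generator commutative analogue over `AddMonoidAlgebra`; it is not re-proved here.)
3. From `e² = e`, `e = r x`, `x e = x`: `E := R(e)` is an admissible idempotent for `R(x)` and
   `P := L(e)` an admissible right idempotent for `L(x)` in the sense of `TwoBlock.IsLeftIdem/IsRightIdem`
   (`isLeftIdem_rightMul`, `isRightIdem_leftMul`; the rank clause by `rank(MN) ≤ rank M, rank N`).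
4. `R(e)` commutes with `L(a)` and `L(e)` with `R(b)` (`leftMul_mul_rightMul_comm`), so Statement 1
   (`TwoBlock.defectX_eq_zero_of_commute`, `defectZ_eq_zero_of_commute`) kills one defect directly; the
   other is the same defect of the transposed pair `(R(b̂), L(â))` (`TwoBlock.defectX_transpose_swap`,
   `G_{â} = G_a`: `suppGroup_comp_inv`).

Scope: the printed general hypothesis of Statement 10 — "the ideals `aR` and `Ra` be semisimple" — is typed in
the form the mechanism uses, `aR = eR` and `Ra = Rf` for idempotents `e`, `f` (direct summands; appended section
`DirectSummand`: `defects_eq_zero_of_idempotent_generators_left/right`); read module-theoretically ("semisimple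
`R`-module") the printed hypothesis is NOT sufficient (`𝔽₂[ℤ₂]`, `a = b = 1+x`: the ideal `(1+x)R ≅ 𝔽₂` is a
simple module but `δ_X = δ_Z = 1`, `TwoBlock.fourTwoTwo_defects`) — recorded in the section docstring, the
simplicity of that module is not itself formalised here.

## References (locators read on the page)

* [EberhardtSteffan2024] J. N. Eberhardt, V. Steffan, *Logical operators and fold-transversal gates of bivariate
  bicycle codes*, IEEE Trans. Inf. Theory (2024) = arXiv:2407.03973: §2.3 Def. 2.2 (chunk p0005 L75–77: pure classes
  `[f,0]`, `[0,g]`), Thm 2.3 (fundamental exact sequence, chunk p0006 L14–33), Cor. 2.5 (chunk p0006 L54: «H is pure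
  if and only if (c) ∩ (d) = (cd)»).
* [LinPryadko2024] H.-K. Lin, L. P. Pryadko, *Quantum two-block group algebra codes*, Phys. Rev. A 109
  (2024) 022407 = arXiv:2306.16400: §II.A (chunk p0004 L97–105: "according to Maschke's theorem, the group
  algebra is semisimple, and any ideal is a principal ideal generated by an idempotent, e.g.,
  J_L = F[G]·f_J for a left ideal"); §III.A Statement 1 (chunk p0006 L134–137); §IV.E (chunk p0011
  L37–46), Statement 10 (tex label th:semisimple; chunk p0011 L48–53), the support-group condition (chunk p0011
  L55–57), its printed proof App. §8.4 (chunk p0019 L87–95); Statement 9 (chunk p0011 L26–35); §III.C Statement 5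
  (chunk p0007 L101–111).
-/

namespace Literature.InformationTheory.QuantumCodes

open Matrix Module

namespace TwoBlockGA

/-! ### The algebra of `L(·)` and `R(·)`: products are convolutions -/

section Algebra

variable {G : Type*} [Group G] [Fintype G] {R : Type*} [CommRing R]

/-- The product `x y` of two group-algebra elements, on coefficient functions, is `L(x) y = R(y) x`.
[cite: LinPryadko2024, §4.1 eq. (10) (arXiv:2306.16400 chunk p0009 L11–31)] -/
theorem leftMul_mulVec_eq_rightMul_mulVec (x y : G → R) : leftMul x *ᵥ y = rightMul y *ᵥ x := by
  funext α
  simp only [mulVec, dotProduct, leftMul_apply, rightMul_apply]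
  refine Fintype.sum_equiv ((Equiv.inv G).trans (Equiv.mulLeft α)) _ _ fun β => ?_
  simp [mul_comm]

/-- `L` is multiplicative: `L(x y) = L(x) L(y)`. [cite: LinPryadko2024, §4.1 eq. (10)–(11) "L(a) … the regular representation" (arXiv:2306.16400 chunk p0009 L11–31)] -/
theorem leftMul_leftMul_mulVec (x y : G → R) : leftMul (leftMul x *ᵥ y) = leftMul x * leftMul y := by
  ext α β
  simp only [leftMul_apply, mulVec, dotProduct, mul_apply]
  refine Fintype.sum_equiv (Equiv.mulRight β) _ _ fun γ => ?_
  simp [mul_assoc]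

/-- `R` is anti-multiplicative: `R(x y) = R(y) R(x)`. [cite: LinPryadko2024, §4.1 eq. (10)–(11) (arXiv:2306.16400 chunk p0009 L11–31)] -/
theorem rightMul_leftMul_mulVec (x y : G → R) : rightMul (leftMul x *ᵥ y) = rightMul y * rightMul x := by
  ext α β
  simp only [leftMul_apply, rightMul_apply, mulVec, dotProduct, mul_apply]
  refine Fintype.sum_equiv ((Equiv.inv G).trans (Equiv.mulLeft α)) _ _ fun γ => ?_
  simp [mul_assoc, mul_comm]

omit [Fintype G] [CommRing R] in
/-- `L(a)ᵀ = L(â)` with `â(g) = a(g⁻¹)`. [cite: LinPryadko2024, §4.1 eq. (12) (arXiv:2306.16400 chunk p0009 L41–45)] -/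
theorem transpose_leftMul (a : G → R) : (leftMul a)ᵀ = leftMul fun g => a g⁻¹ := by
  ext α β
  simp [_root_.mul_inv_rev]

omit [Fintype G] [CommRing R] in
/-- `R(b)ᵀ = R(b̂)`. [cite: LinPryadko2024, §4.1 eq. (12) (arXiv:2306.16400 chunk p0009 L41–45)] -/
theorem transpose_rightMul (b : G → R) : (rightMul b)ᵀ = rightMul fun g => b g⁻¹ := by
  ext α β
  simp [_root_.mul_inv_rev]

end Algebra

/-! ### Maschke: in a semisimple group algebra every left ideal is generated by an idempotent -/

section Maschke

variable {K : Type*} [Group K] [Fintype K] {F : Type*} [Field F]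

omit [Group K] in
/-- The element of Mathlib's group algebra `MonoidAlgebra F K` with coefficient function `u`. [folklore] -/
private noncomputable def toAlg (u : K → F) : MonoidAlgebra F K :=
  .ofCoeff (Finsupp.equivFunOnFinite.symm u)

omit [Group K] in
/-- [folklore] -/
private theorem coe_coeff_toAlg (u : K → F) : ⇑(toAlg u).coeff = u := by
  funext g
  simp [toAlg]

/-- Mathlib's product on `MonoidAlgebra F K`, read on coefficient functions, is `L(x) y`. [folklore] -/
private theorem coe_coeff_mul (x y : MonoidAlgebra F K) :
    ⇑(x * y).coeff = leftMul ⇑x.coeff *ᵥ ⇑y.coeff := by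
  classical
  funext g
  have hs : ∀ {p : K × K}, p ∈ Finset.univ.image (fun h : K => (g * h⁻¹, h)) ↔ p.1 * p.2 = g := by
    intro p
    simp only [Finset.mem_image, Finset.mem_univ, true_and]
    constructor
    · rintro ⟨h, rfl⟩
      exact inv_mul_cancel_right g h
    · intro hp
      exact ⟨p.2, by rw [← hp, mul_inv_cancel_right]⟩
  rw [MonoidAlgebra.coeff_mul_antidiag x y g _ hs,
    Finset.sum_image (by intro h₁ _ h₂ _ h; exact (Prod.ext_iff.mp h).2)]
  simp [Matrix.mulVec, dotProduct]

/-- **Semisimple `F[K]` (`char F ∤ |K|`, Maschke): the left ideal `F[K] x` is generated by an idempotent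
`e = r x` with `x e = x`.** [cite: LinPryadko2024, §II.A "according to Maschke's theorem, the group algebra is semisimple, and any ideal is a principal ideal generated by an idempotent, e.g., J_L = F[G]·f_J for a left ideal" (arXiv:2306.16400 chunk p0004 L97–105) and §IV.E before Statement 10 (chunk p0011 L37–45)] -/
theorem exists_idempotent_leftIdeal [NeZero (Nat.card K : F)] (x : K → F) :
    ∃ e r : K → F, leftMul e *ᵥ e = e ∧ leftMul r *ᵥ x = e ∧ leftMul x *ᵥ e = x := by
  obtain ⟨e, he, hI⟩ := IsSemisimpleRing.ideal_eq_span_idempotent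
    (Ideal.span {toAlg x} : Ideal (MonoidAlgebra F K))
  have he' : e ∈ Ideal.span {toAlg x} := by
    rw [hI]
    exact Ideal.mem_span_singleton_self e
  obtain ⟨r, hr⟩ := Ideal.mem_span_singleton'.mp he'
  have hx' : toAlg x ∈ (Ideal.span {e} : Ideal (MonoidAlgebra F K)) := by
    rw [← hI]
    exact Ideal.mem_span_singleton_self _
  obtain ⟨s, hs⟩ := Ideal.mem_span_singleton'.mp hx'
  have hxe : toAlg x * e = toAlg x := by rw [← hs, mul_assoc, he.eq]
  refine ⟨⇑e.coeff, ⇑r.coeff, ?_, ?_, ?_⟩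
  · have h := congrArg (fun z : MonoidAlgebra F K => ⇑z.coeff) he.eq
    simpa only [coe_coeff_mul] using h
  · have h := congrArg (fun z : MonoidAlgebra F K => ⇑z.coeff) hr
    simpa only [coe_coeff_mul, coe_coeff_toAlg] using h
  · have h := congrArg (fun z : MonoidAlgebra F K => ⇑z.coeff) hxe
    simpa only [coe_coeff_mul, coe_coeff_toAlg] using h

end Maschke

/-! ### From a subgroup to the group: extension by zero is multiplicative -/

section Extend

variable {G : Type*} [Group G] {R : Type*} [CommRing R]

/-- Extension by zero of a coefficient function on a subgroup `H ≤ G` (`F[H] ↪ F[G]`). [folklore] -/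
private def ext0 (H : Subgroup G) [DecidablePred (· ∈ H)] (u : H → R) : G → R :=
  fun g => if hg : g ∈ H then u ⟨g, hg⟩ else 0

/-- [folklore] -/
private theorem ext0_of_mem {H : Subgroup G} [DecidablePred (· ∈ H)] (u : H → R) {g : G} (hg : g ∈ H) :
    ext0 H u g = u ⟨g, hg⟩ := by
  simp [ext0, hg]

/-- [folklore] -/
private theorem ext0_of_not_mem {H : Subgroup G} [DecidablePred (· ∈ H)] (u : H → R) {g : G}
    (hg : g ∉ H) : ext0 H u g = 0 := by
  simp [ext0, hg]

/-- A function supported in `H` is the extension of its restriction. [folklore] -/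
private theorem ext0_restrict {H : Subgroup G} [DecidablePred (· ∈ H)] {x : G → R}
    (hx : ∀ g, x g ≠ 0 → g ∈ H) :
    ext0 H (fun γ => x γ) = x := by
  funext g
  by_cases hg : g ∈ H
  · rw [ext0_of_mem _ hg]
  · rw [ext0_of_not_mem _ hg]
    by_contra h
    exact hg (hx g (Ne.symm h))

variable [Fintype G]

/-- `F[H] ↪ F[G]` is multiplicative: `L(ext u)(ext v) = ext (L(u) v)`. [folklore] -/
private theorem leftMul_ext0_mulVec_ext0 {H : Subgroup G} [DecidablePred (· ∈ H)] [Fintype H]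
    (u v : H → R) : leftMul (ext0 H u) *ᵥ ext0 H v = ext0 H (leftMul u *ᵥ v) := by
  funext g
  simp only [mulVec, dotProduct, leftMul_apply]
  by_cases hg : g ∈ H
  · rw [ext0_of_mem _ hg]
    simp only [mulVec, dotProduct, leftMul_apply]
    have hsub : (Finset.univ : Finset H).map (Function.Embedding.subtype (· ∈ H)) ⊆ Finset.univ :=
      Finset.subset_univ _
    rw [← Finset.sum_subset hsub (fun β _ hβ => ?_), Finset.sum_map]
    · refine Finset.sum_congr rfl fun γ _ => ?_
      have hmem : g * (γ : G)⁻¹ ∈ H := H.mul_mem hg (H.inv_mem γ.2)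
      rw [Function.Embedding.coe_subtype, ext0_of_mem u hmem, ext0_of_mem v γ.2]
      rfl
    · have hβ' : β ∉ H := fun h => hβ (Finset.mem_map.mpr ⟨⟨β, h⟩, Finset.mem_univ _, rfl⟩)
      rw [ext0_of_not_mem v hβ', mul_zero]
  · rw [ext0_of_not_mem _ hg]
    refine Finset.sum_eq_zero fun β _ => ?_
    by_cases hβ : β ∈ H
    · have : g * β⁻¹ ∉ H := fun h => hg (by simpa using H.mul_mem h hβ)
      rw [ext0_of_not_mem u this, zero_mul]
    · rw [ext0_of_not_mem v hβ, mul_zero]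

variable {F : Type*} [Field F]

/-- The idempotent generator for `x` supported in a subgroup `H` with `F[H]` semisimple
(`char F ∤ |H|`), computed in `F[H]` and pushed into `F[G]`.
[cite: LinPryadko2024, §IV.E after Statement 10 "easier to apply condition is, e.g., that the group algebra F[G_a] be semisimple" (arXiv:2306.16400 chunk p0011 L55–57)] -/
theorem exists_idempotent_leftIdeal_of_subgroup (H : Subgroup G) [NeZero (Nat.card H : F)]
    {x : G → F} (hx : ∀ g, x g ≠ 0 → g ∈ H) :
    ∃ e r : G → F, leftMul e *ᵥ e = e ∧ leftMul r *ᵥ x = e ∧ leftMul x *ᵥ e = x := by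
  classical
  obtain ⟨e, r, he, hr, hxe⟩ := exists_idempotent_leftIdeal (K := H) (F := F) fun γ => x γ
  refine ⟨ext0 H e, ext0 H r, ?_, ?_, ?_⟩
  · rw [leftMul_ext0_mulVec_ext0, he]
  · conv_lhs => rw [← ext0_restrict hx, leftMul_ext0_mulVec_ext0, hr]
  · conv_lhs => rw [← ext0_restrict hx, leftMul_ext0_mulVec_ext0, hxe]
    exact ext0_restrict hx

/-- In particular for the support group `G_x = ⟨supp x⟩` with `char F ∤ |G_x|`.
[cite: LinPryadko2024, §IV.E after Statement 10 (arXiv:2306.16400 chunk p0011 L55–57)] -/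
theorem exists_idempotent_leftIdeal_of_card_suppGroup {x : G → F}
    (h : (Nat.card (suppGroup x) : F) ≠ 0) :
    ∃ e r : G → F, leftMul e *ᵥ e = e ∧ leftMul r *ᵥ x = e ∧ leftMul x *ᵥ e = x :=
  haveI : NeZero (Nat.card (suppGroup x) : F) := ⟨h⟩
  exists_idempotent_leftIdeal_of_subgroup (suppGroup x) fun _ hg => mem_suppGroup_of_ne_zero hg

end Extend

/-! ### The printed idempotents `E`, `F` of Statement 1, built from an idempotent generator -/

section Idempotents

variable {G : Type*} [Group G] [Fintype G] {F : Type*} [Field F]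

/-- From `e² = e`, `e = r x`, `x e = x` (left ideal `F[G]x = F[G]e`): `E := R(e)` is an admissible
idempotent for `R(x)` — `E² = E`, `E R(x) = R(x)`, `rank E = rank R(x)` — i.e. the printed `E_B` for
`B = R(x)`. [cite: LinPryadko2024, §III.A "idempotent matrices E_A, F_A with E_A A = A F_A = A, rank E_A = rank F_A = rank A" (arXiv:2306.16400 chunk p0006 L44–52) and §IV.E "we can choose E_A = L(e_a)" (chunk p0011 L41–45)] -/
theorem isLeftIdem_rightMul {e r x : G → F} (he : leftMul e *ᵥ e = e) (hr : leftMul r *ᵥ x = e)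
    (hx : leftMul x *ᵥ e = x) : TwoBlock.IsLeftIdem (rightMul e) (rightMul x) where
  idem := by rw [← rightMul_leftMul_mulVec, he]
  mul_eq := by rw [← rightMul_leftMul_mulVec, hx]
  rank_eq := by
    apply le_antisymm
    · conv_lhs => rw [← hr, rightMul_leftMul_mulVec]
      exact Matrix.rank_mul_le_left _ _
    · conv_lhs => rw [← hx, rightMul_leftMul_mulVec]
      exact Matrix.rank_mul_le_left _ _

/-- From the same data: `P := L(e)` is an admissible right idempotent for `L(x)` — `P² = P`,
`L(x) P = L(x)`, `rank P = rank L(x)` — i.e. the printed `F_A` for `A = L(x)`.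
[cite: LinPryadko2024, §III.A (arXiv:2306.16400 chunk p0006 L44–52) and §IV.E "F_A = L(f_a)" (chunk p0011 L41–45)] -/
theorem isRightIdem_leftMul {e r x : G → F} (he : leftMul e *ᵥ e = e) (hr : leftMul r *ᵥ x = e)
    (hx : leftMul x *ᵥ e = x) : TwoBlock.IsRightIdem (leftMul e) (leftMul x) where
  idem := by rw [← leftMul_leftMul_mulVec, he]
  mul_eq := by rw [← leftMul_leftMul_mulVec, hx]
  rank_eq := by
    apply le_antisymm
    · conv_lhs => rw [← hr, leftMul_leftMul_mulVec]
      exact Matrix.rank_mul_le_right _ _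
    · conv_lhs => rw [← hx, leftMul_leftMul_mulVec]
      exact Matrix.rank_mul_le_right _ _

end Idempotents

/-! ### Statement 10: vanishing rank defects -/

section Defects

variable {G : Type*} [Group G] [Fintype G] {F : Type*} [Field F]

/-- `δ_X(A,B) = δ_X(B,A)` for commuting `A, B` (the intrinsic defect `dim(col A ∩ col B) − rank(AB)` is
symmetric). [cite: LinPryadko2024, §III.A `rank E_A B ≡ p⋆ + δ_X`, `p⋆ = rank(AB)` (tex label eq:rank-defect; arXiv:2306.16400 chunk p0006 L84–89)] -/
theorem _root_.Literature.InformationTheory.QuantumCodes.TwoBlock.defectX_comm {ι : Type*} [Fintype ι]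
    {A B : Matrix ι ι F} (hAB : A * B = B * A) : TwoBlock.defectX A B = TwoBlock.defectX B A := by
  unfold TwoBlock.defectX
  rw [inf_comm, hAB]

/-- `δ_Z(A,B) = δ_Z(B,A)` for commuting `A, B`. [cite: LinPryadko2024, §III.A (tex label eq:rank-defect; arXiv:2306.16400 chunk p0006 L84–89)] -/
theorem _root_.Literature.InformationTheory.QuantumCodes.TwoBlock.defectZ_comm {ι : Type*} [Fintype ι]
    {A B : Matrix ι ι F} (hAB : A * B = B * A) : TwoBlock.defectZ A B = TwoBlock.defectZ B A := by
  unfold TwoBlock.defectZ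
  rw [inf_comm, hAB]

omit [Fintype G] in
/-- `G_{â} = G_a` (`â(g) = a(g⁻¹)`): a subgroup is closed under inversion. [cite: LinPryadko2024, §IV.C "G_a … the subgroup of G generated by elements in the support of a" (arXiv:2306.16400 chunk p0009 L116–121)] -/
theorem suppGroup_comp_inv {R : Type*} [Zero R] (a : G → R) : suppGroup (fun g => a g⁻¹) = suppGroup a := by
  unfold suppGroup
  rw [← Subgroup.closure_inv {g | a g ≠ 0}]
  rfl

/-- **`F[G_b]` semisimple ⇒ `δ_X = δ_Z = 0`** for `LP[a,b]` (`A = L(a)`, `B = R(b)`), any field, any finite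
group: `E_B = R(e_b)` commutes with `A` (Statement 1), and the `Z`-defect is the `X`-defect of the
transposed pair `(R(b̂), L(â))`. [cite: LinPryadko2024, §IV.E Statement 10 and the sentence after it "easier to apply condition is … that the group algebra F[G_a] be semisimple" (arXiv:2306.16400 chunk p0011 L48–57); Statement 1 (chunk p0006 L134–137)] -/
theorem defects_eq_zero_of_card_suppGroup_right (a b : G → F) (hb : (Nat.card (suppGroup b) : F) ≠ 0) :
    TwoBlock.defectX (leftMul a) (rightMul b) = 0 ∧ TwoBlock.defectZ (leftMul a) (rightMul b) = 0 := by
  have hAB := leftMul_mul_rightMul_comm (R := F) a b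
  constructor
  · obtain ⟨e, r, he, hr, hx⟩ := exists_idempotent_leftIdeal_of_card_suppGroup hb
    rw [TwoBlock.defectX_comm hAB]
    exact TwoBlock.defectX_eq_zero_of_commute (isLeftIdem_rightMul he hr hx) hAB.symm
      (leftMul_mul_rightMul_comm a e).symm
  · have hb' : (Nat.card (suppGroup fun g => b g⁻¹) : F) ≠ 0 := by rwa [suppGroup_comp_inv]
    obtain ⟨e, r, he, hr, hx⟩ := exists_idempotent_leftIdeal_of_card_suppGroup hb'
    rw [← TwoBlock.defectX_transpose_swap, transpose_leftMul, transpose_rightMul]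
    exact TwoBlock.defectX_eq_zero_of_commute (isLeftIdem_rightMul he hr hx)
      (leftMul_mul_rightMul_comm _ _).symm (leftMul_mul_rightMul_comm _ e).symm

/-- **`F[G_a]` semisimple ⇒ `δ_X = δ_Z = 0`**: `F_A = L(f_a)` commutes with `B` (Statement 1, `Z`-clause),
and the `X`-defect is the `Z`-defect of the transposed pair. [cite: LinPryadko2024, §IV.E Statement 10 and the sentence after it (arXiv:2306.16400 chunk p0011 L48–57); Statement 1 (chunk p0006 L134–137)] -/
theorem defects_eq_zero_of_card_suppGroup_left (a b : G → F) (ha : (Nat.card (suppGroup a) : F) ≠ 0) :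
    TwoBlock.defectX (leftMul a) (rightMul b) = 0 ∧ TwoBlock.defectZ (leftMul a) (rightMul b) = 0 := by
  have hAB := leftMul_mul_rightMul_comm (R := F) a b
  constructor
  · have ha' : (Nat.card (suppGroup fun g => a g⁻¹) : F) ≠ 0 := by rwa [suppGroup_comp_inv]
    obtain ⟨e, r, he, hr, hx⟩ := exists_idempotent_leftIdeal_of_card_suppGroup ha'
    -- `δ_X(L a, R b) = δ_X(R b, L a) = δ_X((R b̂)ᵀ, (L â)ᵀ) = δ_Z(L â, R b̂)`
    have h1 : TwoBlock.defectX (leftMul a) (rightMul b) =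
        TwoBlock.defectZ (leftMul fun g => a g⁻¹) (rightMul fun g => b g⁻¹) := by
      rw [TwoBlock.defectX_comm hAB, ← TwoBlock.defectX_transpose_swap, transpose_leftMul,
        transpose_rightMul]
      simp only [inv_inv]
    rw [h1]
    exact TwoBlock.defectZ_eq_zero_of_commute (isRightIdem_leftMul he hr hx)
      (leftMul_mul_rightMul_comm _ _) (leftMul_mul_rightMul_comm e _)
  · obtain ⟨e, r, he, hr, hx⟩ := exists_idempotent_leftIdeal_of_card_suppGroup ha
    exact TwoBlock.defectZ_eq_zero_of_commute (isRightIdem_leftMul he hr hx) hAB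
      (leftMul_mul_rightMul_comm e b)

/-- **LP24 Statement 10 (support-group form): if `F[G_a]` or `F[G_b]` is semisimple — the order of the
support group `G_a = ⟨supp a⟩` or `G_b` is prime to `char F` — then the rank defects of `LP[a,b]` vanish,
`δ_X = δ_Z = 0`**, for EVERY finite group `G`. Printed: "Consider a code LP[a,b] over group algebra
R ≡ F[G] such that the ideals aR and Ra (or the two ideals generated by b) be semisimple. Then, rank
defects of the corresponding CSS matrices vanish, δ_X = δ_Z = 0. Somewhat less general but easier to apply
condition is, e.g., that the group algebra F[G_a] be semisimple, i.e., rank of the support group G_a be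
mutually prime with the field characteristic p." The defects are the tree's intrinsic ones
(`TwoBlock.defectX/defectZ`, the least printed defects, `TwoBlockCodeDimension.lean`).
[cite: LinPryadko2024, §IV.E Statement 10 (tex label th:semisimple; arXiv:2306.16400 chunk p0011 L48–53) and the support-group condition after it (chunk p0011 L55–57); printed proof App. §8.4 (chunk p0019 L87–95) via Statement 1 (chunk p0006 L134–137)] -/
theorem LinPryadko2024_statement10 (a b : G → F)
    (h : (Nat.card (suppGroup a) : F) ≠ 0 ∨ (Nat.card (suppGroup b) : F) ≠ 0) :
    TwoBlock.defectX (leftMul a) (rightMul b) = 0 ∧ TwoBlock.defectZ (leftMul a) (rightMul b) = 0 :=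
  h.elim (defects_eq_zero_of_card_suppGroup_left a b) (defects_eq_zero_of_card_suppGroup_right a b)

omit [Fintype G] in
/-- `char F ∤ |G| ⇒ char F ∤ |H|` for a subgroup. [folklore] -/
private theorem cast_card_subgroup_ne_zero [Finite G] (H : Subgroup G) (h : (Nat.card G : F) ≠ 0) :
    (Nat.card H : F) ≠ 0 := by
  intro hH
  apply h
  rw [← Subgroup.card_mul_index H, Nat.cast_mul, hH, zero_mul]

/-- **Semisimple `F[G]` (`char F ∤ |G|`) ⇒ `δ_X = δ_Z = 0` for every 2BGA code over `G`.**
[cite: LinPryadko2024, §IV.E "An alternative sufficient condition follows from Statement 1 in the special case of a semisimple group algebra F[G], i.e., when the field characteristic p and the group rank ℓ are mutually prime" (arXiv:2306.16400 chunk p0011 L37–46)] -/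
theorem defects_eq_zero_of_card (a b : G → F) (h : (Nat.card G : F) ≠ 0) :
    TwoBlock.defectX (leftMul a) (rightMul b) = 0 ∧ TwoBlock.defectZ (leftMul a) (rightMul b) = 0 :=
  LinPryadko2024_statement10 a b (Or.inl (cast_card_subgroup_ne_zero _ h))

end Defects

/-! ### Binary 2BGA codes: `|G_a|` or `|G_b|` odd -/

section Binary

variable {G : Type*} [Group G] [Fintype G]

/-- Over `𝔽₂`: `|G_a|` odd or `|G_b|` odd ⇒ `δ_X = δ_Z = 0`. [cite: LinPryadko2024, §IV.E Statement 10 and the sentence after it (arXiv:2306.16400 chunk p0011 L48–57)] -/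
theorem defects_eq_zero_of_odd (a b : G → ZMod 2)
    (h : Odd (Nat.card (suppGroup a)) ∨ Odd (Nat.card (suppGroup b))) :
    TwoBlock.defectX (leftMul a) (rightMul b) = 0 ∧ TwoBlock.defectZ (leftMul a) (rightMul b) = 0 :=
  LinPryadko2024_statement10 a b
    (h.imp ZMod.natCast_ne_zero_iff_odd.mpr ZMod.natCast_ne_zero_iff_odd.mpr)

variable [DecidableEq G]

/-- Hence `k = 2k_S` (the printed `k = 2k_S + δ_X + δ_Z` with both defects zero).
[cite: LinPryadko2024, §III.A `k = 2k_S + δ_X + δ_Z` (tex label eq:two-block-k; arXiv:2306.16400 chunk p0006 L122–126) with §IV.E Statement 10 (chunk p0011 L48–57)] -/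
theorem css_k_eq_two_mul_kS_of_odd (a b : G → ZMod 2)
    (h : Odd (Nat.card (suppGroup a)) ∨ Odd (Nat.card (suppGroup b))) :
    (css a b).k = 2 * TwoBlock.kS (leftMul a) (rightMul b) := by
  obtain ⟨hX, hZ⟩ := defects_eq_zero_of_odd a b h
  rw [TwoBlock.css_k_eq_ga, hX, hZ, add_zero, add_zero]

/-- … in particular `k` is even. [cite: LinPryadko2024, §III.A with §IV.E Statement 10 (arXiv:2306.16400 chunks p0006 L122–126, p0011 L48–57)] -/
theorem even_css_k_of_odd (a b : G → ZMod 2)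
    (h : Odd (Nat.card (suppGroup a)) ∨ Odd (Nat.card (suppGroup b))) : Even (css a b).k :=
  ⟨_, by rw [css_k_eq_two_mul_kS_of_odd a b h, two_mul]⟩

/-- `|G|` odd ⇒ `k = 2k_S` for every binary 2BGA code over `G`. [cite: LinPryadko2024, §IV.E (arXiv:2306.16400 chunk p0011 L37–46)] -/
theorem css_k_eq_two_mul_kS_of_odd_card (a b : G → ZMod 2) (hG : Odd (Nat.card G)) :
    (css a b).k = 2 * TwoBlock.kS (leftMul a) (rightMul b) :=
  css_k_eq_two_mul_kS_of_odd a b (Or.inl (hG.of_dvd_nat (Subgroup.card_subgroup_dvd_card _)))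

omit [DecidableEq G] in
/-- **Statements 10 + 5 together, binary form: for `|G_a|` or `|G_b|` odd and `k > 0`, the two-sided
single-block-erasure lower bound `d ≥ min(d_Z, d_X over both erasure codes)` holds with NO defect
hypothesis left to check.** The four distance hypotheses are those of `TwoBlock.LinPryadko2024_statement5`
for `A = L(a)`, `B = R(b)`. [cite: LinPryadko2024, §III.C Statement 5 (arXiv:2306.16400 chunk p0007 L101–111) with §IV.E Statement 10 (chunk p0011 L48–57)] -/
theorem le_min_dX_dZ_of_odd (a b : G → ZMod 2)
    (h : Odd (Nat.card (suppGroup a)) ∨ Odd (Nat.card (suppGroup b))) (hk : 0 < (css a b).k) {D : ℕ}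
    (hZL : ∀ u, u ∈ LinearMap.ker (leftMul a).mulVecLin ⊔ TwoBlock.col (rightMul b) →
      u ∉ TwoBlock.col (rightMul b) → D ≤ hammingNorm u)
    (hZR : ∀ v, v ∈ LinearMap.ker (rightMul b).mulVecLin ⊔ TwoBlock.col (leftMul a) →
      v ∉ TwoBlock.col (leftMul a) → D ≤ hammingNorm v)
    (hXL : ∀ u, u ∈ LinearMap.ker (rightMul b)ᵀ.mulVecLin ⊔ TwoBlock.col (leftMul a)ᵀ →
      u ∉ TwoBlock.col (leftMul a)ᵀ → D ≤ hammingNorm u)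
    (hXR : ∀ v, v ∈ LinearMap.ker (leftMul a)ᵀ.mulVecLin ⊔ TwoBlock.col (rightMul b)ᵀ →
      v ∉ TwoBlock.col (rightMul b)ᵀ → D ≤ hammingNorm v) :
    D ≤ min (css a b).dX (css a b).dZ := by
  obtain ⟨hX, hZ⟩ := defects_eq_zero_of_odd a b h
  have h5 := TwoBlock.LinPryadko2024_statement5 (leftMul_mul_rightMul_comm a b) hX hZ hZL hZR hXL hXR
  rw [TwoBlock.HX_leftMul_rightMul, TwoBlock.HZ_leftMul_rightMul, ← css_HX, ← css_HZ,
    CSSCode.cssMinDist_eq_min_dX_dZ _ hk] at h5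
  exact_mod_cast h5

end Binary

/-! ### Statement 10 without semisimplicity: ideals that are direct summands (appended 2026-08-27, qec-lit-3 g6)

What the mechanism really uses is that the right ideal `aR` and the left ideal `Ra` are generated by
IDEMPOTENTS, `aR = eR`, `Ra = Rf` (`e² = e`, `f² = f`) — i.e. that they are direct summands of `R` — or the same
for `b`. No semisimplicity of any algebra is needed; conversely, reading the printed hypothesis "the ideals `aR`
and `Ra` be semisimple" module-theoretically is NOT sufficient: over `𝔽₂[ℤ₂] = 𝔽₂[z]/(z²)` (`z = 1+x`) the ideal
`zR = {0, z}` is a simple — hence semisimple — `R`-module, yet `LP[1+x, 1+x]` (the `[[4,2,2]]` code) has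
`δ_X = δ_Z = 1` (`TwoBlock.fourTwoTwo_defects`, `TwoBlockCodeDimension.lean`); `zR` is not a direct summand
(`R` is local). The theorems below are the direct-summand form, in coefficient language
(`L(x) y = x·y`): right-ideal data `e = a·r`, `a = e·s`; left-ideal data `f = r′·a`, `a = s′·f`. -/

section DirectSummand

variable {G : Type*} [Group G] [Fintype G] {F : Type*} [Field F]

/-- Right-ideal data `aR = eR` (`e² = e`, `e = a r`, `a = e s`) makes `E := L(e)` an admissible idempotent for
`A = L(a)`: `E² = E`, `E A = A`, `rank E = rank A` — the printed `E_A = L(e_a)`.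
[cite: LinPryadko2024, §IV.E "we can choose E_A = L(e_a) … guaranteed to commute with B ≡ R(b)" (arXiv:2306.16400 chunk p0011 L41–45); §II.A "J_R = e_J · F[G] for a right ideal, with idempotent e_J" (chunk p0004 L102–105)] -/
theorem isLeftIdem_leftMul_of_rightIdeal {a e r s : G → F} (he : leftMul e *ᵥ e = e)
    (hr : leftMul a *ᵥ r = e) (hs : leftMul e *ᵥ s = a) : TwoBlock.IsLeftIdem (leftMul e) (leftMul a) where
  idem := by rw [← leftMul_leftMul_mulVec, he]
  mul_eq := by
    -- `e a = e (e s) = e s = a`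
    rw [← leftMul_leftMul_mulVec, ← hs, mulVec_mulVec, ← leftMul_leftMul_mulVec, he]
  rank_eq := by
    apply le_antisymm
    · conv_lhs => rw [← hr, leftMul_leftMul_mulVec]
      exact Matrix.rank_mul_le_left _ _
    · conv_lhs => rw [← hs, leftMul_leftMul_mulVec]
      exact Matrix.rank_mul_le_left _ _

/-- Left-ideal data `Ra = Rf` (`f² = f`, `f = r′ a`, `a = s′ f`) makes `P := L(f)` an admissible right idempotent
for `A = L(a)`: `P² = P`, `A P = A`, `rank P = rank A` — the printed `F_A = L(f_a)`.
[cite: LinPryadko2024, §IV.E "F_A = L(f_a)" (arXiv:2306.16400 chunk p0011 L41–45); §II.A "J_L = F[G]·f_J for a left ideal, with idempotent f_J" (chunk p0004 L101–103)] -/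
theorem isRightIdem_leftMul_of_leftIdeal {a f r s : G → F} (hf : leftMul f *ᵥ f = f)
    (hr : leftMul r *ᵥ a = f) (hs : leftMul s *ᵥ f = a) : TwoBlock.IsRightIdem (leftMul f) (leftMul a) where
  idem := by rw [← leftMul_leftMul_mulVec, hf]
  mul_eq := by
    -- `a f = (s f) f = s f = a`
    rw [← leftMul_leftMul_mulVec]
    conv_lhs => rw [← hs, leftMul_leftMul_mulVec s f, ← mulVec_mulVec, hf]
    rw [hs]
  rank_eq := by
    apply le_antisymm
    · conv_lhs => rw [← hr, leftMul_leftMul_mulVec]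
      exact Matrix.rank_mul_le_right _ _
    · conv_lhs => rw [← hs, leftMul_leftMul_mulVec]
      exact Matrix.rank_mul_le_right _ _

/-- The same two constructions for `B = R(b)`: left-ideal data `Rb = Re` gives the admissible idempotent
`E_B = R(e)` (this is `isLeftIdem_rightMul`), and right-ideal data `bR = fR` (`f² = f`, `f = b r`, `b = f s`)
gives the admissible right idempotent `F_B = R(f)`. [cite: LinPryadko2024, §IV.E (arXiv:2306.16400 chunk p0011 L41–45); §II.A (chunk p0004 L101–105)] -/
theorem isRightIdem_rightMul_of_rightIdeal {b f r s : G → F} (hf : leftMul f *ᵥ f = f)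
    (hr : leftMul b *ᵥ r = f) (hs : leftMul f *ᵥ s = b) : TwoBlock.IsRightIdem (rightMul f) (rightMul b) where
  idem := by rw [← rightMul_leftMul_mulVec, hf]
  mul_eq := by
    -- `R(b) R(f) = R(f b)` and `f b = f (f s) = f s = b`
    rw [← rightMul_leftMul_mulVec]
    conv_lhs => rw [← hs, mulVec_mulVec, ← leftMul_leftMul_mulVec, hf]
    rw [hs]
  rank_eq := by
    apply le_antisymm
    · conv_lhs => rw [← hr, rightMul_leftMul_mulVec]
      exact Matrix.rank_mul_le_right _ _
    · conv_lhs => rw [← hs, rightMul_leftMul_mulVec]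
      exact Matrix.rank_mul_le_right _ _

/-- **Statement 10, direct-summand form, `a`-side: `aR = eR` and `Ra = Rf` with `e² = e`, `f² = f` ⇒
`δ_X = δ_Z = 0`** (any field, any finite group; no semisimplicity). With right-ideal data `E_A = L(e)` commutes
with `B = R(b)` and Statement 1 kills `δ_X`; with left-ideal data `F_A = L(f)` kills `δ_Z`.
[cite: LinPryadko2024, §IV.E Statement 10 (arXiv:2306.16400 chunk p0011 L48–53) with the route L37–46 and Statement 1 (chunk p0006 L134–137)] -/
theorem defects_eq_zero_of_idempotent_generators_left (a b : G → F) {e f r s r' s' : G → F}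
    (he : leftMul e *ᵥ e = e) (hr : leftMul a *ᵥ r = e) (hs : leftMul e *ᵥ s = a)
    (hf : leftMul f *ᵥ f = f) (hr' : leftMul r' *ᵥ a = f) (hs' : leftMul s' *ᵥ f = a) :
    TwoBlock.defectX (leftMul a) (rightMul b) = 0 ∧ TwoBlock.defectZ (leftMul a) (rightMul b) = 0 :=
  ⟨TwoBlock.defectX_eq_zero_of_commute (isLeftIdem_leftMul_of_rightIdeal he hr hs)
      (leftMul_mul_rightMul_comm a b) (leftMul_mul_rightMul_comm e b),
    TwoBlock.defectZ_eq_zero_of_commute (isRightIdem_leftMul_of_leftIdeal hf hr' hs')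
      (leftMul_mul_rightMul_comm a b) (leftMul_mul_rightMul_comm f b)⟩

/-- **Statement 10, direct-summand form, `b`-side: `Rb = Re` and `bR = fR` with `e² = e`, `f² = f` ⇒
`δ_X = δ_Z = 0`.** [cite: LinPryadko2024, §IV.E Statement 10 "(or the two ideals generated by b)" (arXiv:2306.16400 chunk p0011 L48–53); Statement 1 (chunk p0006 L134–137)] -/
theorem defects_eq_zero_of_idempotent_generators_right (a b : G → F) {e f r r' s' : G → F}
    (he : leftMul e *ᵥ e = e) (hr : leftMul r *ᵥ b = e) (hs : leftMul b *ᵥ e = b)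
    (hf : leftMul f *ᵥ f = f) (hr' : leftMul b *ᵥ r' = f) (hs' : leftMul f *ᵥ s' = b) :
    TwoBlock.defectX (leftMul a) (rightMul b) = 0 ∧ TwoBlock.defectZ (leftMul a) (rightMul b) = 0 := by
  have hAB := leftMul_mul_rightMul_comm (R := F) a b
  constructor
  · rw [TwoBlock.defectX_comm hAB]
    exact TwoBlock.defectX_eq_zero_of_commute (isLeftIdem_rightMul he hr hs) hAB.symm
      (leftMul_mul_rightMul_comm a e).symm
  · rw [TwoBlock.defectZ_comm hAB]
    exact TwoBlock.defectZ_eq_zero_of_commute (isRightIdem_rightMul_of_rightIdeal hf hr' hs') hAB.symm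
      (leftMul_mul_rightMul_comm a f).symm

end DirectSummand

end TwoBlockGA

/-! ### Re-indexing invariance of the defects, and the abelian two-block codes -/

namespace TwoBlock

variable {F : Type*} [Field F] {ι κ : Type*} [Fintype ι] [Fintype κ]

omit [Field F] [Fintype ι] [Fintype κ] in
/-- `H_X` of a simultaneously re-indexed pair is the re-indexed `H_X`. [folklore] -/
private theorem HX_submatrix (A B : Matrix ι ι F) (e : κ ≃ ι) :
    HX (A.submatrix e e) (B.submatrix e e) = (HX A B).submatrix e (Equiv.sumCongr e e) := by
  ext i (j | j) <;> rfl

/-- `δ_X` is invariant under a simultaneous permutation of rows and columns (permutation-equivalent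
codes). [cite: LinPryadko2024, §4.2 Thm 6 (i) "permutation equivalent" (arXiv:2306.16400 chunk p0009 L66–74)] -/
theorem defectX_submatrix (A B : Matrix ι ι F) (e : κ ≃ ι) :
    defectX (A.submatrix e e) (B.submatrix e e) = defectX A B := by
  have h1 := rank_HX_add_finrank_inf (A.submatrix e e) (B.submatrix e e)
  have h2 := rank_HX_add_finrank_inf A B
  rw [HX_submatrix, rank_submatrix, rank_submatrix, rank_submatrix] at h1
  unfold defectX
  rw [submatrix_mul_equiv, rank_submatrix]
  omega

/-- `δ_Z` is invariant under a simultaneous permutation of rows and columns. [cite: LinPryadko2024, §4.2 Thm 6 (i) (arXiv:2306.16400 chunk p0009 L66–74)] -/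
theorem defectZ_submatrix (A B : Matrix ι ι F) (e : κ ≃ ι) :
    defectZ (A.submatrix e e) (B.submatrix e e) = defectZ A B := by
  rw [← defectX_transpose_swap, ← defectX_transpose_swap, transpose_submatrix, transpose_submatrix,
    defectX_submatrix]

/-- `k_S` is invariant under a simultaneous permutation of rows and columns. [cite: LinPryadko2024, §4.2 Thm 6 (i) (arXiv:2306.16400 chunk p0009 L66–74)] -/
theorem kS_submatrix (A B : Matrix ι ι F) (e : κ ≃ ι) :
    kS (A.submatrix e e) (B.submatrix e e) = kS A B := by
  unfold kS
  rw [submatrix_mul_equiv, rank_submatrix, rank_submatrix, rank_submatrix, Fintype.card_congr e]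

end TwoBlock

namespace AbelianTwoBlock

variable {G : Type*} [AddCommGroup G] [Fintype G] {F : Type*} [Field F]

/-- The abelian two-block pair `(circulant a, circulant b)` is the re-indexed `(L(a), R(b))` over
`Multiplicative G`, so its defects are those of the 2BGA code. [cite: LinPryadko2024, §4.2 "with an abelian group G, for any a ∈ F[G], L(a) = R(a)" (arXiv:2306.16400 chunk p0009 L95–96)] -/
theorem defectX_circulant_eq (a b : G → F) :
    TwoBlock.defectX (circulant a) (circulant b) =
      TwoBlock.defectX (TwoBlockGA.leftMul (G := Multiplicative G) fun g => a g.toAdd)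
        (TwoBlockGA.rightMul (G := Multiplicative G) fun g => b g.toAdd) := by
  rw [TwoBlockGA.leftMul_eq_circulant, TwoBlockGA.rightMul_eq_circulant,
    TwoBlock.defectX_submatrix _ _ (Multiplicative.toAdd : Multiplicative G ≃ G)]

/-- … and likewise `δ_Z`. [cite: LinPryadko2024, §4.2 (arXiv:2306.16400 chunk p0009 L95–96)] -/
theorem defectZ_circulant_eq (a b : G → F) :
    TwoBlock.defectZ (circulant a) (circulant b) =
      TwoBlock.defectZ (TwoBlockGA.leftMul (G := Multiplicative G) fun g => a g.toAdd)
        (TwoBlockGA.rightMul (G := Multiplicative G) fun g => b g.toAdd) := by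
  rw [TwoBlockGA.leftMul_eq_circulant, TwoBlockGA.rightMul_eq_circulant,
    TwoBlock.defectZ_submatrix _ _ (Multiplicative.toAdd : Multiplicative G ≃ G)]

/-- **Semisimple `F[G]`, `G` abelian (`char F ∤ |G|`) ⇒ `δ_X = δ_Z = 0`** for every abelian two-block
code `(circulant a, circulant b)` — the semisimple case of Statement 9's "δ_X = δ_Z = 0 for any abelian
2BGA code" (which FAILS without semisimplicity: `TwoBlock.fourTwoTwo_defects`).
[cite: LinPryadko2024, §IV.E Statement 10 (arXiv:2306.16400 chunk p0011 L48–57) and Statement 9 (chunk p0011 L26–35)] -/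
theorem defects_eq_zero_of_card (a b : G → F) (h : (Nat.card G : F) ≠ 0) :
    TwoBlock.defectX (circulant a) (circulant b) = 0 ∧ TwoBlock.defectZ (circulant a) (circulant b) = 0 := by
  rw [defectX_circulant_eq, defectZ_circulant_eq]
  exact TwoBlockGA.defects_eq_zero_of_card _ _ h

/-- Over `𝔽₂`: `|⟨supp a⟩|` odd or `|⟨supp b⟩|` odd ⇒ `δ_X = δ_Z = 0` for the abelian two-block code
(GB codes: `G = ℤ_ℓ`; BB codes: `G = ℤ_ℓ × ℤ_m`). [cite: LinPryadko2024, §IV.E Statement 10 and the sentence after it (arXiv:2306.16400 chunk p0011 L48–57)] -/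
theorem defects_eq_zero_of_odd (a b : G → ZMod 2)
    (h : Odd (Nat.card (AddSubgroup.closure {g : G | a g ≠ 0})) ∨
      Odd (Nat.card (AddSubgroup.closure {g : G | b g ≠ 0}))) :
    TwoBlock.defectX (circulant a) (circulant b) = 0 ∧ TwoBlock.defectZ (circulant a) (circulant b) = 0 := by
  rw [defectX_circulant_eq, defectZ_circulant_eq]
  refine TwoBlockGA.defects_eq_zero_of_odd _ _ ?_
  rwa [card_suppGroup_multiplicative, card_suppGroup_multiplicative]

variable [DecidableEq G]

/-- Hence `k = 2k_S` for such abelian codes. [cite: LinPryadko2024, §III.A `k = 2k_S + δ_X + δ_Z` (arXiv:2306.16400 chunk p0006 L122–126) with §IV.E Statement 10 (chunk p0011 L48–57)] -/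
theorem css_k_eq_two_mul_kS_of_odd (a b : G → ZMod 2)
    (h : Odd (Nat.card (AddSubgroup.closure {g : G | a g ≠ 0})) ∨
      Odd (Nat.card (AddSubgroup.closure {g : G | b g ≠ 0}))) :
    (css a b).k = 2 * TwoBlock.kS (circulant a) (circulant b) := by
  obtain ⟨hX, hZ⟩ := defects_eq_zero_of_odd a b h
  rw [TwoBlock.css_k_eq_abelian, hX, hZ, add_zero, add_zero]

/-- `|G|` odd ⇒ `k = 2k_S` for every binary abelian two-block code over `G`.
[cite: LinPryadko2024, §IV.E (arXiv:2306.16400 chunk p0011 L37–46)] -/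
theorem css_k_eq_two_mul_kS_of_odd_card (a b : G → ZMod 2) (hG : Odd (Nat.card G)) :
    (css a b).k = 2 * TwoBlock.kS (circulant a) (circulant b) :=
  css_k_eq_two_mul_kS_of_odd a b
    (Or.inl (hG.of_dvd_nat (AddSubgroup.card_addSubgroup_dvd_card _)))

end AbelianTwoBlock

/-! ### One-block codeword bases (LP24 §IV.E: "their codeword basis can be chosen so that each codeword is
supported on only one block") — appended 2026-08-27, qec-lit-3 g6: `δ_X = 0` ALONE is equivalent to the one-block
decomposition of every `Z`-codeword modulo `Z`-stabilizers, `δ_Z = 0` to that of every `X`-codeword.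

IN PRINT for codes over a COMMUTATIVE ring `R` (`c, d ∈ R`, qubits `R ⊕ R`): Eberhardt–Steffan [EberhardtSteffan2024,
Cor. 2.5] (arXiv:2407.03973 chunk p0006 L54): «The homology `H` is pure, that is `H = H_hor + H_ver`, if and only if
`(c) ∩ (d) = (cd)`» (pure = generated by one-block classes `[f,0]`, `[0,g]`, Def. 2.2, chunk p0005 L75–77) — with
`(c) ∩ (d) = (cd)` ⟺ `δ_X = 0` (`defectX_eq_zero_iff`). The theorems below are the same equivalence for an arbitrary
commuting pair of square matrices over a field (the two-block setting of LP24 §III), proved directly. -/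

namespace TwoBlock

variable {F : Type*} [Field F] {ι : Type*} [Fintype ι]

/-- **`δ_X = 0` ⇒ every `Z`-codeword is a `Z`-stabilizer plus two single-block `Z`-codewords:**
`Au + Bv = 0 ⟹ (u;v) = (Bt; −At) + (u₀; 0) + (0; v₀)` with `Au₀ = 0`, `Bv₀ = 0`. (Proof: `w = Au = −Bv ∈
col A ∩ col B = col(AB)`, so `w = ABt`; take `u₀ = u − Bt`, `v₀ = v + At`.)
[cite: LinPryadko2024, §IV.E "The semi-abelian 2BGA codes whose CSS generator matrices have the property δ_X = δ_Z = 0 are special: their codeword basis can be chosen so that each codeword is supported on only one block" (arXiv:2306.16400 chunk p0011 L59–65); §III.C (chunk p0007 L106–115)]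
[cite: EberhardtSteffan2024, Cor. 2.5 "H is pure … if and only if (c) ∩ (d) = (cd)" (arXiv:2407.03973 chunk p0006 L54) — the commutative-ring case] -/
theorem exists_oneBlock_of_defectX_eq_zero {A B : Matrix ι ι F} (hAB : A * B = B * A) (hX : defectX A B = 0)
    {u v : ι → F} (h : A *ᵥ u + B *ᵥ v = 0) :
    ∃ t u₀ v₀ : ι → F, A *ᵥ u₀ = 0 ∧ B *ᵥ v₀ = 0 ∧ u = B *ᵥ t + u₀ ∧ v = -(A *ᵥ t) + v₀ := by
  have hw : A *ᵥ u ∈ col A ⊓ col B := by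
    refine ⟨⟨u, rfl⟩, ⟨-v, ?_⟩⟩
    rw [Matrix.mulVecLin_apply, mulVec_neg, neg_eq_iff_add_eq_zero, add_comm, h]
  rw [← (defectX_eq_zero_iff hAB).1 hX] at hw
  obtain ⟨t, ht⟩ := hw
  rw [Matrix.mulVecLin_apply, ← mulVec_mulVec] at ht
  refine ⟨t, u - B *ᵥ t, v + A *ᵥ t, ?_, ?_, by abel, by abel⟩
  · rw [mulVec_sub, ← ht, sub_self]
  · rw [mulVec_add, mulVec_mulVec, ← hAB, ← mulVec_mulVec, ht, add_comm, h]

/-- **Conversely, the one-block decomposition of all `Z`-codewords forces `δ_X = 0`**; so `δ_X = 0` is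
EQUIVALENT to "every `Z`-codeword is a stabilizer plus single-block codewords" (the `Z`-half of the printed
sentence needs `δ_X = 0` only). [cite: EberhardtSteffan2024, Cor. 2.5 (arXiv:2407.03973 chunk p0006 L54: «H is pure, that is H = H_hor + H_ver, if and only if (c) ∩ (d) = (cd)», codes over a commutative ring — this is its two-block / commuting-matrix form)] [cite: LinPryadko2024, §IV.E (arXiv:2306.16400 chunk p0011 L59–65) with §III.C (chunk p0007 L106–115)] -/
theorem defectX_eq_zero_iff_oneBlock {A B : Matrix ι ι F} (hAB : A * B = B * A) :
    defectX A B = 0 ↔ ∀ u v : ι → F, A *ᵥ u + B *ᵥ v = 0 →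
      ∃ t u₀ v₀ : ι → F, A *ᵥ u₀ = 0 ∧ B *ᵥ v₀ = 0 ∧ u = B *ᵥ t + u₀ ∧ v = -(A *ᵥ t) + v₀ := by
  refine ⟨fun hX u v h => exists_oneBlock_of_defectX_eq_zero hAB hX h, fun H => ?_⟩
  rw [defectX_eq_zero_iff hAB]
  refine le_antisymm (col_mul_le_inf' hAB) ?_
  rintro w ⟨⟨u, rfl⟩, ⟨v', hv'⟩⟩
  rw [Matrix.mulVecLin_apply, Matrix.mulVecLin_apply] at hv'
  rw [Matrix.mulVecLin_apply]
  obtain ⟨t, u₀, v₀, hu₀, -, rfl, -⟩ := H u (-v') (by rw [mulVec_neg, hv', add_neg_cancel])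
  refine ⟨t, ?_⟩
  rw [Matrix.mulVecLin_apply, mulVec_add, hu₀, add_zero, mulVec_mulVec]
where
  /-- `col(AB) ≤ col A ⊓ col B` for commuting `A, B`. [folklore] -/
  col_mul_le_inf' {A B : Matrix ι ι F} (hAB : A * B = B * A) : col (A * B) ≤ col A ⊓ col B := by
    rintro _ ⟨v, rfl⟩
    refine ⟨⟨B *ᵥ v, ?_⟩, ⟨A *ᵥ v, ?_⟩⟩
    · simp [Matrix.mulVec_mulVec]
    · simp [Matrix.mulVec_mulVec, hAB]

/-- **`δ_Z = 0` ⇒ every `X`-codeword is an `X`-stabilizer plus two single-block `X`-codewords:**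
`Bᵀu = Aᵀv ⟹ (u;v) = (Aᵀt; Bᵀt) + (u₀; 0) + (0; v₀)` with `Bᵀu₀ = 0`, `Aᵀv₀ = 0` (the `Z`-statement for the
transposed pair `(Bᵀ, Aᵀ)`, `δ_X(Bᵀ,Aᵀ) = δ_Z(A,B)`). [cite: LinPryadko2024, §IV.E (arXiv:2306.16400 chunk p0011 L59–65); App. A.5 "CSS symmetry combined with the block permutation symmetry gives the other bound" (chunk p0016 L90–92)] -/
theorem exists_oneBlock_of_defectZ_eq_zero {A B : Matrix ι ι F} (hAB : A * B = B * A) (hZ : defectZ A B = 0)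
    {u v : ι → F} (h : Bᵀ *ᵥ u = Aᵀ *ᵥ v) :
    ∃ t u₀ v₀ : ι → F, Bᵀ *ᵥ u₀ = 0 ∧ Aᵀ *ᵥ v₀ = 0 ∧ u = Aᵀ *ᵥ t + u₀ ∧ v = Bᵀ *ᵥ t + v₀ := by
  have hT : Bᵀ * Aᵀ = Aᵀ * Bᵀ := by rw [← transpose_mul, ← transpose_mul, hAB]
  rw [← defectX_transpose_swap] at hZ
  obtain ⟨t, u₀, v₀, hu₀, hv₀, hu, hv⟩ := exists_oneBlock_of_defectX_eq_zero hT hZ (u := u) (v := -v)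
    (by rw [mulVec_neg, h, add_neg_cancel])
  refine ⟨t, u₀, -v₀, hu₀, by rw [mulVec_neg, hv₀, neg_zero], hu, ?_⟩
  rw [← neg_neg v, hv, neg_add, neg_neg]

end TwoBlock

namespace TwoBlockGA

variable {G : Type*} [Group G] [Fintype G]

/-- **Binary 2BGA codes with `|G_a|` or `|G_b|` odd have one-block logical bases in BOTH sectors:** every
`Z`-codeword `(u;v)` (`L(a)u + R(b)v = 0`) is `(R(b)t; L(a)t) + (u₀;0) + (0;v₀)` with `L(a)u₀ = 0`,
`R(b)v₀ = 0` (over `𝔽₂`, `−At = At`). [cite: LinPryadko2024, §IV.E Statement 10 and "their codeword basis can be chosen so that each codeword is supported on only one block" (arXiv:2306.16400 chunk p0011 L48–65)] -/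
theorem zCodeword_oneBlock_of_odd (a b : G → ZMod 2)
    (hodd : Odd (Nat.card (suppGroup a)) ∨ Odd (Nat.card (suppGroup b))) {u v : G → ZMod 2}
    (h : leftMul a *ᵥ u + rightMul b *ᵥ v = 0) :
    ∃ t u₀ v₀ : G → ZMod 2, leftMul a *ᵥ u₀ = 0 ∧ rightMul b *ᵥ v₀ = 0 ∧
      u = rightMul b *ᵥ t + u₀ ∧ v = -(leftMul a *ᵥ t) + v₀ :=
  TwoBlock.exists_oneBlock_of_defectX_eq_zero (leftMul_mul_rightMul_comm a b)
    (defects_eq_zero_of_odd a b hodd).1 h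

/-- … and every `X`-codeword `(u;v)` (`R(b)ᵀu = L(a)ᵀv`) is `(L(a)ᵀt; R(b)ᵀt) + (u₀;0) + (0;v₀)` with
`R(b)ᵀu₀ = 0`, `L(a)ᵀv₀ = 0`. [cite: LinPryadko2024, §IV.E Statement 10 and the one-block sentence (arXiv:2306.16400 chunk p0011 L48–65)] -/
theorem xCodeword_oneBlock_of_odd (a b : G → ZMod 2)
    (hodd : Odd (Nat.card (suppGroup a)) ∨ Odd (Nat.card (suppGroup b))) {u v : G → ZMod 2}
    (h : (rightMul b)ᵀ *ᵥ u = (leftMul a)ᵀ *ᵥ v) :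
    ∃ t u₀ v₀ : G → ZMod 2, (rightMul b)ᵀ *ᵥ u₀ = 0 ∧ (leftMul a)ᵀ *ᵥ v₀ = 0 ∧
      u = (leftMul a)ᵀ *ᵥ t + u₀ ∧ v = (rightMul b)ᵀ *ᵥ t + v₀ :=
  TwoBlock.exists_oneBlock_of_defectZ_eq_zero (leftMul_mul_rightMul_comm a b)
    (defects_eq_zero_of_odd a b hodd).2 h

end TwoBlockGA

/-! ### Abelian codes: an explicit idempotent CERTIFICATE `aR = eR` gives `δ_X = δ_Z = 0` (appended 2026-08-27, qec-lit-3 g6)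

For a commutative group algebra one-sided data suffices (`aR = Ra`): three convolution identities `e ⋆ e = e`,
`a ⋆ r = e`, `e ⋆ s = a` — decidable for a concrete code — certify both defects, with no hypothesis on `|G|`
(useful for the even-order BB / GB rows where Maschke is unavailable). -/

namespace AbelianTwoBlock

variable {G : Type*} [AddCommGroup G] [Fintype G] {F : Type*} [Field F]

/-- An idempotent certificate `e ⋆ e = e`, `a ⋆ r = e`, `e ⋆ s = a` (`aR = eR` in the commutative `F[G]`) makes
`circulant e` an admissible idempotent for `circulant a` on BOTH sides (`E_A = F_A = circulant e`).
[cite: LinPryadko2024, §IV.E "idempotent elements e_a, f_a … E_A = L(e_a), F_A = L(f_a)" (arXiv:2306.16400 chunk p0011 L41–45); §II.A (chunk p0004 L97–105)] -/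
theorem isLeftIdem_circulant_of_certificate {a e r s : G → F} (he : circulant e *ᵥ e = e)
    (hr : circulant a *ᵥ r = e) (hs : circulant e *ᵥ s = a) :
    TwoBlock.IsLeftIdem (circulant e) (circulant a) ∧ TwoBlock.IsRightIdem (circulant e) (circulant a) := by
  have hidem : circulant e * circulant e = circulant e := by rw [circulant_mul, he]
  have hea : circulant e * circulant a = circulant a := by
    rw [circulant_mul, ← hs, mulVec_mulVec, circulant_mul, he]
  have hrank : (circulant e).rank = (circulant a).rank := by
    apply le_antisymm
    · conv_lhs => rw [← hr, ← circulant_mul]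
      exact Matrix.rank_mul_le_left _ _
    · conv_lhs => rw [← hea]
      exact Matrix.rank_mul_le_left _ _
  exact ⟨⟨hidem, hea, hrank⟩, ⟨hidem, by rw [circulant_mul_comm, hea], hrank⟩⟩

/-- **Certificate form of Statement 10 for abelian two-block codes:** `e ⋆ e = e`, `a ⋆ r = e`, `e ⋆ s = a` ⇒
`δ_X = δ_Z = 0` for `(circulant a, circulant b)` — any field, any finite abelian `G`, ANY `b`.
[cite: LinPryadko2024, §IV.E Statement 10 (arXiv:2306.16400 chunk p0011 L48–53) with Statement 1 (chunk p0006 L134–137)] -/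
theorem defects_eq_zero_of_certificate (a b : G → F) {e r s : G → F} (he : circulant e *ᵥ e = e)
    (hr : circulant a *ᵥ r = e) (hs : circulant e *ᵥ s = a) :
    TwoBlock.defectX (circulant a) (circulant b) = 0 ∧ TwoBlock.defectZ (circulant a) (circulant b) = 0 := by
  obtain ⟨hE, hP⟩ := isLeftIdem_circulant_of_certificate he hr hs
  exact ⟨TwoBlock.defectX_eq_zero_of_commute hE (circulant_mul_comm a b) (circulant_mul_comm e b),
    TwoBlock.defectZ_eq_zero_of_commute hP (circulant_mul_comm a b) (circulant_mul_comm e b)⟩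

/-- … and symmetrically a certificate for `b` (`bR = eR`) certifies both defects.
[cite: LinPryadko2024, §IV.E Statement 10 "(or the two ideals generated by b)" (arXiv:2306.16400 chunk p0011 L48–53)] -/
theorem defects_eq_zero_of_certificate_right (a b : G → F) {e r s : G → F} (he : circulant e *ᵥ e = e)
    (hr : circulant b *ᵥ r = e) (hs : circulant e *ᵥ s = b) :
    TwoBlock.defectX (circulant a) (circulant b) = 0 ∧ TwoBlock.defectZ (circulant a) (circulant b) = 0 := by
  obtain ⟨hX, hZ⟩ := defects_eq_zero_of_certificate b a he hr hs
  exact ⟨by rw [TwoBlock.defectX_comm (circulant_mul_comm a b)]; exact hX,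
    by rw [TwoBlock.defectZ_comm (circulant_mul_comm a b)]; exact hZ⟩

variable [DecidableEq G] in
/-- Over `𝔽₂`: a certificate gives `k = 2k_S` for the abelian code `css a b`.
[cite: LinPryadko2024, §III.A `k = 2k_S + δ_X + δ_Z` (arXiv:2306.16400 chunk p0006 L122–126) with §IV.E Statement 10 (chunk p0011 L48–53)] -/
theorem css_k_eq_two_mul_kS_of_certificate (a b : G → ZMod 2) {e r s : G → ZMod 2}
    (he : circulant e *ᵥ e = e) (hr : circulant a *ᵥ r = e) (hs : circulant e *ᵥ s = a) :
    (css a b).k = 2 * TwoBlock.kS (circulant a) (circulant b) := by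
  obtain ⟨hX, hZ⟩ := defects_eq_zero_of_certificate a b he hr hs
  rw [TwoBlock.css_k_eq_abelian, hX, hZ, add_zero, add_zero]

end AbelianTwoBlock

end Literature.InformationTheory.QuantumCodes
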